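import Summits.PneNP.PneNP.Theorems.ExpanderLinearGeneratorsGridRoutingDefs
import Literature.Combinatorics.SimpleGraph.RandomLiftExistence

/-!
# PneNP / ExpanderLinearGenerators — the grid routing system overlaid with a graph: definitions

Route `PneNP/ExpanderLinearGenerators`, support for crux stmt-PneNP-11443
(`LinearGeneratorDepthFregeHard`). The grid routing Tseitin system (`…GridRoutingDefs`,
`…GridRoutingSystem`) is hard for bounded-depth Frege (`…GridRoutingLowerBound`) but, being
planar, it is not a boundary expander at the crux's rate `3ℓ/4`. We OVERLAY it with a simple graph
`G` on `C` copies of its row set: the rows of the new system are the vertices `(c, i)` of `G`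
(`c < C`, `i` a grid row), its variables are the grid variables together with the edges of `G`;
the equation of `(c, i)` is the grid equation of `i` when `c = 0` (charge included) plus the sum of
the `G`-edges at `(c, i)`, and just the latter (charge `0`) when `c ≠ 0`. Setting the edge
variables to `⊥` recovers the grid system (`killSubst`), so hardness transfers
(`…GridRoutingOverlayTransfer`); for `C = 57` and a `56`-regular locally sparse `G` the overlaid
system is an `(r, 45)`-boundary expander with supports `≤ 60` (`…GridRoutingOverlayExpansion`) —
the hypotheses of the crux with `ℓ = 60` (`…GridRoutingCruxFamily`).

* `overlaySystem k C G` (rows `ORows k C = C · nRows k`, variables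
  `OVars k C G = nVars k + |E(G)|`, numberings `orowEquiv`, `ovarEquiv`, `edgeOf`), its scopes
  `oscope`, the killing substitution `killSubst` / `killVals`, and the constants `transferConst`
  (polynomial transfer bound) and `liftConst = 128 · (16·57)⁸` (sparsity radius of the lift).

References: E. Ben-Sasson, Comput. Complexity 11 (2002), §4 (hard expanding instances by
combining); A. Urquhart, X. Fu, NDJFL 37 (1996); J. Krajíček, *Proof complexity* (CUP 2019),
Problem 19.4.5.
-/

namespace Summit.PneNP.PneNP.Theorems.GridRouting

set_option linter.dupNamespace false -- `Summit.PneNP.PneNP.…`: summit = sub-problem (D-0017)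

open Finset Literature.Computability.Complexity.PropForm
open Literature.Computability.Complexity (PropForm)
open Literature.Computability.MetaComplexity Literature.Computability.MetaComplexity.TextbookFrege

variable (k C : ℕ) (G : SimpleGraph (Fin C × Fin (nRows k))) [DecidableRel G.Adj]

/-- Number of equations of the overlaid system: `C` copies of the grid rows. -/
abbrev ORows : ℕ := C * nRows k

/-- Number of variables of the overlaid system: grid variables and edges of `G`. -/
abbrev OVars : ℕ := nVars k + G.edgeFinset.card

/-- The numbering of the rows `(c, i) ↦ i + nRows · c`. -/
def orowEquiv : Fin C × Fin (nRows k) ≃ Fin (ORows k C) := finProdFinEquiv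

/-- The numbering of the variables: grid variables first, then the edges of `G`. -/
def ovarEquiv : Fin (nVars k) ⊕ Fin G.edgeFinset.card ≃ Fin (OVars k C G) := finSumFinEquiv

/-- The enumeration of the edges of `G`. -/
noncomputable def edgeEnum : Fin G.edgeFinset.card ≃ G.edgeFinset := G.edgeFinset.equivFin.symm

/-- The edge of `G` numbered `e`, as an unordered pair. -/
noncomputable def edgeOf (e : Fin G.edgeFinset.card) : Sym2 (Fin C × Fin (nRows k)) :=
  ((edgeEnum k C G e : G.edgeFinset) : Sym2 _)

/-- Coefficients of the overlaid system at the vertex `v = (c, i)`. -/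
noncomputable def ocoef (v : Fin C × Fin (nRows k)) : Fin (nVars k) ⊕ Fin G.edgeFinset.card → ZMod 2
  | Sum.inl j => if (v.1 : ℕ) = 0 then (gridSystem k v.2).1 j else 0
  | Sum.inr e => if v ∈ edgeOf k C G e then 1 else 0

/-- Charges of the overlaid system: the grid charge on copy `0`, zero elsewhere. -/
def ocharge (v : Fin C × Fin (nRows k)) : ZMod 2 :=
  if (v.1 : ℕ) = 0 then (gridSystem k v.2).2 else 0

/-- **The overlaid system.** -/
noncomputable def overlaySystem : Fin (ORows k C) → LinEqMod 2 (OVars k C G) := fun i =>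
  (fun x => ocoef k C G ((orowEquiv k C).symm i) ((ovarEquiv k C G).symm x),
    ocharge k C ((orowEquiv k C).symm i))

variable {k C G}

/-- The scopes of the overlaid system: supports as sets of natural numbers. -/
noncomputable def oscope (k C : ℕ) (G : SimpleGraph (Fin C × Fin (nRows k))) [DecidableRel G.Adj]
    (i : Fin (ORows k C)) : Finset ℕ :=
  (overlaySystem k C G i).supp.map Fin.valEmbedding

/-- The killing substitution: grid variables stay, edge variables become `⊥`. -/
def killSubst (k : ℕ) (x : ℕ) : PropForm ℕ := if x < nVars k then var x else const false

/-- The killed assignment: grid variables per `τ`, edge variables false. -/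
def killVals (k : ℕ) (τ : ℕ → Bool) (x : ℕ) : Bool := if x < nVars k then τ x else false

/-- The constant of the polynomial transfer bound (`T₁ = tautLines 21 1`):
`1000 · (17 T₁ + 126000)`. -/
def transferConst : ℕ := 1000 * (17 * tautLines (4 + 16 + 1) 1 + 126000)

/-- The sparsity constant of the lift of `K₅₇` with `q = 8`: `C₈ = 128 · (16·57)⁸`
(`exists_sparse_lift`). -/
abbrev liftConst : ℕ := 128 * (16 * 57) ^ 8

end Summit.PneNP.PneNP.Theorems.GridRouting
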